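import Summits.CriticalPhenomena.PercolationContinuityZ3.Theorems.PercNearOneGluingNoHeavyLowerTailSahiE3BlockLayers
import Mathlib.Algebra.BigOperators.Field
import Mathlib.Tactic.Linarith
import Mathlib.Tactic.LinearCombination
import Mathlib.Tactic.Ring
import Mathlib.Tactic.Positivity
import HarnessLib
import HarnessLib.Audit

/-!
# `NoHeavyLowerTail` (crux stmt-CriticalPhenomena-4575), Sahi programme P4: the INDEPENDENT OR-step `V ∨ G` —
# reduction to the flat pair inequality (the averaged composite certificate)

Support file (cell `prim-l12`, seat P4, generation 16; `--supports stmt-CriticalPhenomena-4575`).  No named facts, no sorries;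
standard axioms; def-free.

Setting (normalised): finite posets `B`, `Q` with weights `w, ν' ≥ 0` of total mass `1`, subsets `V ⊆ B` (`v = w(V)`, `v̄ = w(Vᶜ)`)
and `G ⊆ Q` (`u' = ν'(G)`, `d' = ν'(Gᶜ)`) carrying exact flow certificates `(R_V, F_V)`, `(R', F')` ((R0), (F0), (F≤), (cap), (K) with
equality — the conditions of `…SahiE3PatternCertificate.phi_nonneg_of_patternCertificate`; the pair inequalities of the two
sub-certificates are not needed in this file), the layered weight `ν(b,s) = w_b ν'(s)` on `B × Q` and the slot
`U = V × Q ∪ B × G` ("`V ∨ G`": the OR of two slots on DISJOINT sets of variables).  The FLAT composite (gens 13–15) has retained mass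
`(1+v̄d') w ν'` on `V × G`, `ν'(s)(R_V(b) − v̄u'w_b)` on `V × Gᶜ`, `w_b(v ν'(s) + v̄R'(s))` on `Vᶜ × G`; its TRANSPOSE (the flat
composite of `G ∨ V` on `Q × B`, read back on `B × Q`) has `ν'(s)(u'w_b + d'R_V(b))` on `V × Gᶜ` and `w_b(R'(s) − v d'ν'(s))` on
`Vᶜ × G`.  For a non-principal `V` the flat composite can have NEGATIVE retained mass on `V × Gᶜ` (e.g. `V = x₀ ∧ (x₁ ∨ x₂)`, where
the natural certificate of `V` retains little on `x₀x₁x̄₂`), and the transpose on `Vᶜ × G`; their AVERAGE is manifestly nonnegative: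
`ν'(s)((1+d')R_V(b) + u'v w_b)/2` on `V × Gᶜ`, `w_b((1+v̄)R'(s) + u'v ν'(s))/2` on `Vᶜ × G`, and it is served by the vertical flows
`((1+d')/2) ν'(s') F_V(b,b')` inside the columns `s' ∉ G` and the horizontal flows `((1+v̄)/2) w_{b'} F'(s,s')` inside the rows
`b' ∉ V` (exact deliveries since `((1+d')v + (1+v̄)u')/2 = v + v̄u' = ν(U)`; every cap is tight).

THEOREM `cert_indep_or_step_norm_of_pair`: if the pair inequality `need(S,S') ≤ R(S ∩ S' ∩ U)` holds for the flat composite AND for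
its transpose (hypotheses `hflat`, `hflatT`, for all up-sets `S, S'` of `B × Q`), then the averaged composite is an exact flow
certificate of `U` (pair by averaging, the rest by bookkeeping) — so the independent OR-step `V ∨ G` is REDUCED to one inequality,
the flat pair inequality, applied to `(B,V;Q,G)` and to `(Q,G;B,V)`.  Exact numerics of this generation (HOME
prim-l12-p4/FROM-prim-l12-p4-gen16-INDEPENDENT-OR.md): the flat pair inequality holds with ADVERSARIAL sub-certificates (minimum over
the whole certificate polytopes of `V` and of `G`, exact LPs) in all `7 × 16` sixteen-point configurations (`14 196` up-set pairs each)
and for the natural certificates of all 3-variable `V` and 2-variable `G` in `256` thirty-two-point configurations (`2.87·10⁷` up-set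
pairs each, kit job recorded in HOME STATUS), the minimum slack being exactly `0`.
-/

namespace Summit.CriticalPhenomena.PercolationContinuityZ3.Theorems.SahiE3IndepOrReduction

open Finset SahiE3BlockLayers
open scoped BigOperators

variable {B Q : Type*} [Fintype B] [DecidableEq B] [Fintype Q] [DecidableEq Q]

/-! ### Bookkeeping on `B × Q` -/

/-- The complement of the slot `U = {b ∈ V ∨ s ∈ G}` is the rectangle `Vᶜ × Gᶜ`. [this work] -/
theorem compl_slot_eq (V : Finset B) (G : Finset Q) (U : Finset (B × Q))
    (hU : ∀ x, x ∈ U ↔ (x.1 ∈ V ∨ x.2 ∈ G)) : Uᶜ = Vᶜ ×ˢ Gᶜ := by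
  ext ⟨b, s⟩
  simp only [Finset.mem_compl, hU, not_or, Finset.mem_product]

/-- A sum over `Uᶜ` is a double sum over `b ∉ V`, `s ∉ G`. [this work] -/
theorem sum_compl_slot (V : Finset B) (G : Finset Q) (U : Finset (B × Q))
    (hU : ∀ x, x ∈ U ↔ (x.1 ∈ V ∨ x.2 ∈ G)) (f : B × Q → ℝ) :
    ∑ y ∈ Uᶜ, f y = ∑ b ∈ Vᶜ, ∑ s ∈ Gᶜ, f (b, s) := by
  rw [compl_slot_eq V G U hU, Finset.sum_product]

omit [DecidableEq B] [DecidableEq Q] in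
/-- A sum over `U` of a function vanishing off `U` is the full double sum. [folklore] -/
theorem sum_slot_of_vanish (U : Finset (B × Q)) (f : B × Q → ℝ) (hf : ∀ x, x ∉ U → f x = 0) :
    ∑ x ∈ U, f x = ∑ b, ∑ s, f (b, s) := by
  rw [← Fintype.sum_prod_type, ← Finset.sum_subset (Finset.subset_univ U)]
  intro x _ hx; exact hf x hx

/-- Mass of the complement of the slot: `ν(Uᶜ) = v̄ d'`. [this work] -/
theorem mass_compl_slot (w : B → ℝ) (ν' : Q → ℝ) (ν : B × Q → ℝ) (hν : ∀ b s, ν (b, s) = w b * ν' s)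
    (V : Finset B) (G : Finset Q) (U : Finset (B × Q)) (hU : ∀ x, x ∈ U ↔ (x.1 ∈ V ∨ x.2 ∈ G)) :
    ∑ y ∈ Uᶜ, ν y = (∑ b ∈ Vᶜ, w b) * ∑ s ∈ Gᶜ, ν' s := by
  rw [sum_compl_slot V G U hU, Finset.sum_mul]
  refine Finset.sum_congr rfl fun b _ => ?_
  rw [Finset.mul_sum]
  exact Finset.sum_congr rfl fun s _ => hν b s

omit [DecidableEq Q] in
/-- `Σ_b [b ∈ V] F b = Σ_{b ∈ V} F b`. [folklore] -/
theorem sum_ite_mem_univB (V : Finset B) (F : B → ℝ) :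
    ∑ b, (if b ∈ V then F b else 0) = ∑ b ∈ V, F b := by
  rw [← Finset.sum_filter, Finset.filter_mem_eq_inter, Finset.univ_inter]

/-! ### The reduction -/

/-- **The independent OR-step, reduced to the flat pair inequality** (normalised weights).  See the module docstring: given exact
flow certificates for `V ⊆ B` and `G ⊆ Q` and the pair inequality for the flat composite (`hflat`) and for its transpose (`hflatT`),
the averaged composite is an exact flow certificate for `U = V × Q ∪ B × G`. [this work] -/
theorem cert_indep_or_step_norm_of_pair [PartialOrder B] [PartialOrder Q]
    {w : B → ℝ} (hw : ∀ b, 0 ≤ w b) (hW : ∑ b, w b = 1)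
    (V : Finset B) (RV : B → ℝ) (FV : B → B → ℝ)
    (hRV0 : ∀ b ∈ V, 0 ≤ RV b) (hFV0 : ∀ b b', 0 ≤ FV b b') (hFVle : ∀ b b', FV b b' ≠ 0 → b' ≤ b)
    (hcapV : ∀ b ∈ V, RV b + ∑ b' ∈ Vᶜ, FV b b' ≤ (∑ r, w r) * ((∑ r, w r) + ∑ r ∈ Vᶜ, w r) * w b)
    (hKV : ∀ b' ∈ Vᶜ, ∑ b ∈ V, FV b b' = (∑ r, w r) * (∑ r ∈ V, w r) * w b')
    {ν' : Q → ℝ} (hν' : ∀ s, 0 ≤ ν' s) (hZ : ∑ s, ν' s = 1)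
    (G : Finset Q) (R' : Q → ℝ) (F' : Q → Q → ℝ)
    (hR'0 : ∀ s ∈ G, 0 ≤ R' s) (hF'0 : ∀ s s', 0 ≤ F' s s') (hF'le : ∀ s s', F' s s' ≠ 0 → s' ≤ s)
    (hcap' : ∀ s ∈ G, R' s + ∑ s' ∈ Gᶜ, F' s s' ≤ (∑ r, ν' r) * ((∑ r, ν' r) + ∑ r ∈ Gᶜ, ν' r) * ν' s)
    (hK' : ∀ s' ∈ Gᶜ, ∑ s ∈ G, F' s s' = (∑ r, ν' r) * (∑ r ∈ G, ν' r) * ν' s')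
    {v vb up dp : ℝ} (hv : ∑ b ∈ V, w b = v) (hvb : ∑ b ∈ Vᶜ, w b = vb) (hup : ∑ s ∈ G, ν' s = up)
    (hdp : ∑ s ∈ Gᶜ, ν' s = dp)
    (ν : B × Q → ℝ) (hν : ∀ b s, ν (b, s) = w b * ν' s)
    (U : Finset (B × Q)) (hU : ∀ x, x ∈ U ↔ (x.1 ∈ V ∨ x.2 ∈ G))
    (hflat : ∀ S S' : Finset (B × Q), IsUpperSet (S : Set (B × Q)) → IsUpperSet (S' : Set (B × Q)) →
      (∑ r, ν r) * ((∑ x ∈ S, ν x) * (∑ x ∈ S' ∩ U, ν x) + (∑ x ∈ S', ν x) * (∑ x ∈ S ∩ U, ν x))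
          - (∑ r ∈ U, ν r) * (∑ x ∈ S, ν x) * (∑ x ∈ S', ν x)
        ≤ ∑ x ∈ (S ∩ S') ∩ U, (if x.1 ∈ V then (if x.2 ∈ G then (1 + vb * dp) * (w x.1 * ν' x.2)
            else ν' x.2 * (RV x.1 - vb * up * w x.1))
          else (if x.2 ∈ G then w x.1 * (v * ν' x.2 + vb * R' x.2) else 0)))
    (hflatT : ∀ S S' : Finset (B × Q), IsUpperSet (S : Set (B × Q)) → IsUpperSet (S' : Set (B × Q)) →
      (∑ r, ν r) * ((∑ x ∈ S, ν x) * (∑ x ∈ S' ∩ U, ν x) + (∑ x ∈ S', ν x) * (∑ x ∈ S ∩ U, ν x))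
          - (∑ r ∈ U, ν r) * (∑ x ∈ S, ν x) * (∑ x ∈ S', ν x)
        ≤ ∑ x ∈ (S ∩ S') ∩ U, (if x.1 ∈ V then (if x.2 ∈ G then (1 + vb * dp) * (w x.1 * ν' x.2)
            else ν' x.2 * (up * w x.1 + dp * RV x.1))
          else (if x.2 ∈ G then w x.1 * (R' x.2 - v * dp * ν' x.2) else 0))) :
    ∃ (R : B × Q → ℝ) (Fl : (B × Q) → (B × Q) → ℝ),
      (∀ x ∈ U, 0 ≤ R x) ∧ (∀ x y, 0 ≤ Fl x y) ∧ (∀ x y, Fl x y ≠ 0 → y ≤ x) ∧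
      (∀ x ∈ U, R x + ∑ y ∈ Uᶜ, Fl x y ≤ (∑ r, ν r) * ((∑ r, ν r) + ∑ r ∈ Uᶜ, ν r) * ν x) ∧
      (∀ y ∈ Uᶜ, ∑ x ∈ U, Fl x y = (∑ r, ν r) * (∑ r ∈ U, ν r) * ν y) ∧
      (∀ S S' : Finset (B × Q), IsUpperSet (S : Set (B × Q)) → IsUpperSet (S' : Set (B × Q)) →
        (∑ r, ν r) * ((∑ x ∈ S, ν x) * (∑ x ∈ S' ∩ U, ν x) + (∑ x ∈ S', ν x) * (∑ x ∈ S ∩ U, ν x))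
            - (∑ r ∈ U, ν r) * (∑ x ∈ S, ν x) * (∑ x ∈ S', ν x) ≤ ∑ x ∈ (S ∩ S') ∩ U, R x) := by
  -- normalised constants
  rw [hW, hvb] at hcapV; rw [hW, hv] at hKV; rw [hZ, hdp] at hcap'; rw [hZ, hup] at hK'
  have hv0 : 0 ≤ v := hv ▸ Finset.sum_nonneg fun b _ => hw b
  have hvb0 : 0 ≤ vb := hvb ▸ Finset.sum_nonneg fun b _ => hw b
  have hup0 : 0 ≤ up := hup ▸ Finset.sum_nonneg fun s _ => hν' s
  have hdp0 : 0 ≤ dp := hdp ▸ Finset.sum_nonneg fun s _ => hν' s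
  have hvvb : v + vb = 1 := by rw [← hv, ← hvb, Finset.sum_add_sum_compl, hW]
  have hud : up + dp = 1 := by rw [← hup, ← hdp, Finset.sum_add_sum_compl, hZ]
  -- masses
  have eZ : ∑ x, ν x = 1 := by rw [mass_univ w ν' ν hν, hW, hZ, one_mul]
  have eUc : ∑ x ∈ Uᶜ, ν x = vb * dp := by rw [mass_compl_slot w ν' ν hν V G U hU, hvb, hdp]
  have eU : ∑ x ∈ U, ν x = v + vb * up := by
    have h := Finset.sum_add_sum_compl U ν
    rw [eZ, eUc] at h
    nlinarith [h, hvvb, hud]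
  have memU : ∀ (b : B) (s : Q), ((b, s) ∈ U) ↔ (b ∈ V ∨ s ∈ G) := fun b s => hU (b, s)
  -- out-flows of the sub-certificates
  have outV : ∀ b ∈ V, ∑ b' ∈ Vᶜ, FV b b' ≤ (1 + vb) * w b - RV b := fun b hb => by
    have := hcapV b hb; linarith
  have outG : ∀ s ∈ G, ∑ s' ∈ Gᶜ, F' s s' ≤ (1 + dp) * ν' s - R' s := fun s hs => by
    have := hcap' s hs; linarith
  -- the averaged composite: retained mass `(flat + flatT)/2`, flows vertical `AV` and horizontal `AG`
  set AV : B → B → Q → ℝ := fun b b' s' => if b ∈ V ∧ s' ∉ G then (1 + dp) / 2 * ν' s' * FV b b' else 0 with hAV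
  set AG : Q → B → Q → ℝ := fun s b' s' => if s ∈ G ∧ b' ∉ V then (1 + vb) / 2 * w b' * F' s s' else 0 with hAG
  have hAV0 : ∀ b b' s', 0 ≤ AV b b' s' := fun b b' s' => by
    simp only [hAV]; have := hFV0 b b'; have := hν' s'; split_ifs <;> positivity
  have hAG0 : ∀ s b' s', 0 ≤ AG s b' s' := fun s b' s' => by
    simp only [hAG]; have := hF'0 s s'; have := hw b'; split_ifs <;> positivity
  refine ⟨fun x => ((if x.1 ∈ V then (if x.2 ∈ G then (1 + vb * dp) * (w x.1 * ν' x.2)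
        else ν' x.2 * (RV x.1 - vb * up * w x.1))
      else (if x.2 ∈ G then w x.1 * (v * ν' x.2 + vb * R' x.2) else 0)) +
      (if x.1 ∈ V then (if x.2 ∈ G then (1 + vb * dp) * (w x.1 * ν' x.2)
        else ν' x.2 * (up * w x.1 + dp * RV x.1))
      else (if x.2 ∈ G then w x.1 * (R' x.2 - v * dp * ν' x.2) else 0))) / 2,
    fun x y => (if x.2 = y.2 then AV x.1 y.1 y.2 else 0) + (if x.1 = y.1 then AG x.2 y.1 y.2 else 0),
    ?_, ?_, ?_, ?_, ?_, ?_⟩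
  · -- (R0)
    rintro ⟨b, s⟩ hx
    dsimp only
    by_cases hb : b ∈ V
    · by_cases hs : s ∈ G
      · simp only [hb, hs, ↓reduceIte]
        have := hw b; have := hν' s
        positivity
      · simp only [hb, hs, ↓reduceIte]
        have h1 : ν' s * (RV b - vb * up * w b) + ν' s * (up * w b + dp * RV b) =
            ν' s * ((1 + dp) * RV b + up * v * w b) := by linear_combination (-(ν' s * up * w b)) * hvvb
        rw [h1]
        have := hRV0 b hb; have := hν' s; have := hw b
        positivity
    · have hs : s ∈ G := by have := (memU b s).1 hx; tauto
      simp only [hb, hs, ↓reduceIte]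
      have h1 : w b * (v * ν' s + vb * R' s) + w b * (R' s - v * dp * ν' s) =
          w b * ((1 + vb) * R' s + up * v * ν' s) := by linear_combination (-(w b * v * ν' s)) * hud
      rw [h1]
      have := hR'0 s hs; have := hν' s; have := hw b
      positivity
  · -- (F0)
    rintro ⟨b, s⟩ ⟨b', s'⟩
    dsimp only
    have := hAV0 b b' s'; have := hAG0 s b' s'
    refine add_nonneg ?_ ?_ <;> split_ifs <;> positivity
  · -- (F≤)
    rintro ⟨b, s⟩ ⟨b', s'⟩ h
    dsimp only at h
    have hsum : (if s = s' then AV b b' s' else 0) ≠ 0 ∨ (if b = b' then AG s b' s' else 0) ≠ 0 := by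
      by_contra hcon
      rw [not_or, not_ne_iff, not_ne_iff] at hcon
      exact h (by rw [hcon.1, hcon.2, add_zero])
    rcases hsum with h1 | h1
    · have hss : s = s' := by by_contra hne; exact h1 (if_neg hne)
      rw [if_pos hss] at h1
      have hF : FV b b' ≠ 0 := by
        intro h0; apply h1; simp only [hAV, h0, mul_zero, ite_self]
      exact ⟨hFVle b b' hF, le_of_eq hss.symm⟩
    · have hbb : b = b' := by by_contra hne; exact h1 (if_neg hne)
      rw [if_pos hbb] at h1
      have hF : F' s s' ≠ 0 := by
        intro h0; apply h1; simp only [hAG, h0, mul_zero, ite_self]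
      exact ⟨le_of_eq hbb.symm, hF'le s s' hF⟩
  · -- (cap)
    rintro ⟨b, s⟩ hx
    rw [eZ, eUc, one_mul, hν, sum_compl_slot V G U hU]
    dsimp only
    rw [Finset.sum_comm]
    simp only [Finset.sum_add_distrib]
    rw [Finset.sum_comm, show ∑ b' ∈ Vᶜ, ∑ s' ∈ Gᶜ, (if s = s' then AV b b' s' else 0) =
        ∑ b' ∈ Vᶜ, (if s ∈ Gᶜ then AV b b' s else 0) from
          Finset.sum_congr rfl fun b' _ => Finset.sum_ite_eq Gᶜ s _,
      show ∑ s' ∈ Gᶜ, ∑ b' ∈ Vᶜ, (if b = b' then AG s b' s' else 0) =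
        ∑ s' ∈ Gᶜ, (if b ∈ Vᶜ then AG s b s' else 0) from
          Finset.sum_congr rfl fun s' _ => Finset.sum_ite_eq Vᶜ b _]
    by_cases hb : b ∈ V
    · have hbc : b ∉ Vᶜ := by simpa using hb
      by_cases hs : s ∈ G
      · -- top-in cell: no out-flow
        have hsc : s ∉ Gᶜ := by simpa using hs
        simp only [hb, hs, hbc, hsc, ↓reduceIte, Finset.sum_const_zero, add_zero]
        have := hw b; have := hν' s
        nlinarith [mul_nonneg (mul_nonneg hvb0 hdp0) (mul_nonneg (hw b) (hν' s))]
      · -- top-off cell: vertical out-flow `((1+d')/2) ν'(s) Σ_{b' ∉ V} F_V(b,b')`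
        have hsc : s ∈ Gᶜ := by simpa using hs
        simp only [hb, hs, hbc, hsc, ↓reduceIte, Finset.sum_const_zero, add_zero, hAV, not_false_eq_true,
          and_self]
        rw [← Finset.mul_sum]
        have h1 := outV b hb
        have h2 : 0 ≤ (1 + dp) / 2 * ν' s := by have := hν' s; positivity
        have h3 := mul_le_mul_of_nonneg_left h1 h2
        have hid : (1 + vb * dp) * (w b * ν' s) = (ν' s * (RV b - vb * up * w b) + ν' s * (up * w b + dp * RV b)) / 2
            + (1 + dp) / 2 * ν' s * ((1 + vb) * w b - RV b) := by
          linear_combination (-(ν' s * w b / 2 * (1 - vb))) * hud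
        linarith [h3, hid]
    · have hs : s ∈ G := by have := (memU b s).1 hx; tauto
      have hbc : b ∈ Vᶜ := by simpa using hb
      have hsc : s ∉ Gᶜ := by simpa using hs
      -- low-in cell: horizontal out-flow `((1+v̄)/2) w_b Σ_{s' ∉ G} F'(s,s')`
      simp only [hb, hs, hbc, hsc, ↓reduceIte, Finset.sum_const_zero, zero_add, hAG, not_false_eq_true, and_self]
      rw [← Finset.mul_sum]
      have h1 := outG s hs
      have h2 : 0 ≤ (1 + vb) / 2 * w b := by have := hw b; positivity
      have h3 := mul_le_mul_of_nonneg_left h1 h2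
      have hid : (1 + vb * dp) * (w b * ν' s) = (w b * (v * ν' s + vb * R' s) + w b * (R' s - v * dp * ν' s)) / 2
          + (1 + vb) / 2 * w b * ((1 + dp) * ν' s - R' s) := by
        linear_combination (-(w b * ν' s / 2 * (1 - dp))) * hvvb
      linarith [h3, hid]
  · -- (K) with equality
    rintro ⟨b', s'⟩ hy
    have hy' : b' ∉ V ∧ s' ∉ G := by
      have := (memU b' s').not.1 (Finset.mem_compl.1 hy); tauto
    obtain ⟨hb', hs'⟩ := hy'
    rw [eZ, eU, one_mul, hν]
    rw [sum_slot_of_vanish U _ (fun x hxU => by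
      obtain ⟨b, s⟩ := x
      have hbs : b ∉ V ∧ s ∉ G := by have := (memU b s).not.1 hxU; tauto
      dsimp only
      simp only [hAV, hAG, hbs.1, hbs.2, false_and, ↓reduceIte, ite_self, add_zero])]
    dsimp only
    simp only [Finset.sum_add_distrib]
    rw [show ∑ b, ∑ s, (if s = s' then AV b b' s' else 0) = ∑ b, AV b b' s' from
        Finset.sum_congr rfl fun b _ => by rw [Finset.sum_ite_eq' univ s', if_pos (Finset.mem_univ _)],
      Finset.sum_comm,
      show ∑ s, ∑ b, (if b = b' then AG s b' s' else 0) = ∑ s, AG s b' s' from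
        Finset.sum_congr rfl fun s _ => by rw [Finset.sum_ite_eq' univ b', if_pos (Finset.mem_univ _)]]
    simp only [hAV, hAG, hb', hs', not_false_eq_true, and_true]
    rw [sum_ite_mem_univB V, show ∑ s, (if s ∈ G then (1 + vb) / 2 * w b' * F' s s' else 0) =
        ∑ s ∈ G, (1 + vb) / 2 * w b' * F' s s' from by
          rw [← Finset.sum_filter, Finset.filter_mem_eq_inter, Finset.univ_inter],
      ← Finset.mul_sum, ← Finset.mul_sum, hKV b' (by simpa using hb'), hK' s' (by simpa using hs')]
    linear_combination (w b' * ν' s' / 2 * v) * hud - (w b' * ν' s' / 2 * up) * hvvb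
  · -- (pair): the average of the two flat pair inequalities
    intro S S' hS hS'
    have h1 := hflat S S' hS hS'
    have h2 := hflatT S S' hS hS'
    rw [← Finset.sum_div, Finset.sum_add_distrib]
    linarith

end Summit.CriticalPhenomena.PercolationContinuityZ3.Theorems.SahiE3IndepOrReduction
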